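import Summits.Ventures.PercRepro0.RightCont
import Summits.Ventures.PercRepro0.Independence

/-!
# Finite energy on the cell's definitions (UNIQUENESS-p6-v1, Lemma 2.1), seat p6

Kernel-checked twin of `proofs/UNIQUENESS-p6-v1.md` §2 (Lemma 2.1: the inside configuration may be chosen
as a function of the outside) directly on `Defs.lean` (p5), using p2's cylinder events `cylS` / `extCfg`
(`RightCont.lean`, G2) and p5's F5 (`Independence.lean`) instead of the product factorisation (B1b):

* `modified F s A` = `A^s` = `{ω : ω agrees on F with s(ω ∖ F), and some inside completion of ω ∖ F lies in A}`;
* `finite_energy`: `min(p, 1−p)^{|F|} · P_p(A) ≤ P_p(A^s)` for a finite bond set `F`, a measurable `A` and a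
  choice `s : Config d → (F → Bool)` with measurable level sets — the paper's proof: `A^s` is the disjoint
  union over `η` of `cylS F η ∩ ({s(· ∖ F) = η} ∩ π(A))`, the two factors are `F_F`- and `F_{Fᶜ}`-measurable
  (F5 gives the product), `P_p(cylS F η) ≥ min(p, 1−p)^{|F|}` (`measure_cylS`), `Σ_η P(…) = P(π(A)) ≥ P(A)`;
* `finite_energy_allOpen`: the constant choice «all bonds of `F` open» (used by Step 2 of the uniqueness proof).
The abstract product form `FiniteEnergy.prod_measure_choice_le` (p411865) is not needed here.
-/

namespace Summit.Ventures.PercRepro0.FiniteEnergyDefs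

open MeasureTheory ProbabilityTheory unitInterval Set Function
open scoped ENNReal
open Summit.Ventures.PercRepro0.Defs
open Summit.Ventures.PercRepro0.L2 (cylS extCfg mem_cylS mem_extCfg measurableSet_cylS measure_cylS)

/-! ## Measurability for the exterior σ-algebra -/

section General

variable {ι : Type*}

/-- Closing the bonds of `F` is measurable for `F_{Fᶜ}` (after p5's `measurable_sdiff_sigmaOn`, HOME copy
`ZeroOne-p5-e028e919.lean`, which is not in the tree). -/
theorem measurable_sdiff_sigmaOn_compl (F : Set ι) :
    @Measurable (Set ι) (Set ι) (sigmaOn Fᶜ) _ (fun ω => ω \ F) := by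
  refine (@measurable_set_iff _ _ (sigmaOn Fᶜ) (fun ω => ω \ F)).2 fun a => ?_
  by_cases ha : a ∈ F
  · have h : (fun ω : Set ι => a ∈ ω \ F) = fun _ => False := by
      funext ω
      simp [ha]
    rw [h]
    exact measurable_const
  · have h : (fun ω : Set ι => a ∈ ω \ F) = fun ω => a ∈ ω := by
      funext ω
      simp [ha]
    rw [h]
    exact Measurable.of_comap_le (le_iSup₂ (f := fun e (_ : e ∈ Fᶜ) => coordSigma e) a ha)

/-- Adjoining a fixed set of bonds is measurable. -/
theorem measurable_const_union {α : Type*} [MeasurableSpace α] {f : α → Set ι} (hf : Measurable f)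
    (c : Set ι) : Measurable fun x => c ∪ f x := by
  refine measurable_set_iff.2 fun a => ?_
  by_cases ha : a ∈ c
  · have h : (fun x => a ∈ c ∪ f x) = fun _ => True := by
      funext x
      simp [ha]
    rw [h]
    exact measurable_const
  · have h : (fun x => a ∈ c ∪ f x) = fun x => a ∈ f x := by
      funext x
      simp [ha]
    rw [h]
    exact measurable_set_iff.1 hf a

end General

variable {d : ℕ}

/-- A cylinder event on `F` is `F_F`-measurable. -/
theorem measurableSet_sigmaOn_cylS (F : Finset (Sym2 (Vertex d))) (η : F → Bool) :
    MeasurableSet[sigmaOn (F : Set (Sym2 (Vertex d)))] (cylS F η) := by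
  have : cylS F η = ⋂ e : F, {ω : Config d | (e : Sym2 (Vertex d)) ∈ ω ↔ η e = true} := by
    ext ω
    simp only [mem_cylS, Set.mem_iInter, Set.mem_setOf_eq]
  rw [this]
  refine MeasurableSet.iInter (m := sigmaOn _) fun e => ?_
  by_cases hη : η e = true
  · simp only [hη, iff_true]
    exact measurableSet_sigmaOn_mem e.2
  · simp only [hη, Bool.false_eq_true, iff_false]
    exact MeasurableSet.compl (m := sigmaOn _) (measurableSet_sigmaOn_mem e.2)

/-- The finite-energy constant `min(p, 1 − p)`. -/
noncomputable def feConst (p : I) : ℝ≥0∞ := min (toNNReal p : ℝ≥0∞) (toNNReal (σ p) : ℝ≥0∞)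

/-- `min(p, 1−p) > 0` for `0 < p < 1`. -/
theorem feConst_pos {p : I} (hp0 : (0 : ℝ) < p) (hp1 : (p : ℝ) < 1) : 0 < feConst p := by
  unfold feConst
  rw [lt_min_iff]
  constructor
  · rw [ENNReal.coe_pos]
    exact (NNReal.coe_pos).1 (by rw [coe_toNNReal]; exact hp0)
  · rw [ENNReal.coe_pos]
    refine (NNReal.coe_pos).1 ?_
    rw [coe_toNNReal, coe_symm_eq]
    linarith

/-- Every cylinder on a finite bond set `F` has probability at least `min(p, 1−p)^{|F|}`. -/
theorem feConst_pow_le_measure_cylS (p : I) (F : Finset (Sym2 (Vertex d))) (hF : ∀ e ∈ F, e ∈ bonds d)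
    (η : F → Bool) : feConst p ^ F.card ≤ P d p (cylS F η) := by
  rw [measure_cylS F hF η p]
  calc feConst p ^ F.card = ∏ _e : F, feConst p := by
        rw [Finset.prod_const, Finset.card_univ, Fintype.card_coe]
    _ ≤ ∏ e : F, (if η e then (toNNReal p : ℝ≥0∞) else (toNNReal (σ p) : ℝ≥0∞)) := by
        refine Finset.prod_le_prod' fun e _ => ?_
        unfold feConst
        split_ifs
        · exact min_le_left _ _
        · exact min_le_right _ _

/-! ## Lemma 2.1 -/

/-- `A^s`: the configurations which agree on `F` with `s(ω ∖ F)` and whose exterior part `ω ∖ F` admits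
some inside completion lying in `A`. -/
def modified (F : Finset (Sym2 (Vertex d))) (s : Config d → (F → Bool)) (A : Set (Config d)) :
    Set (Config d) :=
  {ω | ω ∈ cylS F (s (ω \ F)) ∧ ∃ η : F → Bool, extCfg F η ∪ (ω \ F) ∈ A}

/-- Lemma 2.1 (finite energy; the inside configuration may be chosen as a function of the outside):
`min(p, 1−p)^{|F|} · P_p(A) ≤ P_p(A^s)`. -/
theorem finite_energy (p : I) (F : Finset (Sym2 (Vertex d))) (hF : ∀ e ∈ F, e ∈ bonds d)
    {A : Set (Config d)} (hA : MeasurableSet A) (s : Config d → (F → Bool))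
    (hs : ∀ η, MeasurableSet {ω | s ω = η}) :
    feConst p ^ F.card * P d p A ≤ P d p (modified F s A) := by
  classical
  -- the projection `π(A)`: exterior parts admitting an inside completion in `A`
  set π : Set (Config d) := {ω | ∃ η : F → Bool, extCfg F η ∪ (ω \ F) ∈ A} with hπ
  have hsd : @Measurable (Config d) (Config d) (sigmaOn ((F : Set (Sym2 (Vertex d)))ᶜ)) _
      (fun ω => ω \ F) := measurable_sdiff_sigmaOn_compl _
  have hπ_meas : MeasurableSet[sigmaOn ((F : Set (Sym2 (Vertex d)))ᶜ)] π := by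
    have : π = ⋃ η : F → Bool, (fun ω : Config d => extCfg F η ∪ (ω \ F)) ⁻¹' A := by
      ext ω
      simp only [hπ, Set.mem_setOf_eq, Set.mem_iUnion, Set.mem_preimage]
    rw [this]
    refine MeasurableSet.iUnion (m := sigmaOn _) fun η => ?_
    exact (@measurable_const_union _ _ (sigmaOn _) _ hsd (extCfg F η)) hA
  have hlev : ∀ η, MeasurableSet[sigmaOn ((F : Set (Sym2 (Vertex d)))ᶜ)] {ω | s (ω \ F) = η} :=
    fun η => hsd (hs η)
  -- the exterior pieces `Q η = {s(· ∖ F) = η} ∩ π(A)`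
  set Q : (F → Bool) → Set (Config d) := fun η => {ω | s (ω \ F) = η} ∩ π with hQ
  have hQ_meas : ∀ η, MeasurableSet[sigmaOn ((F : Set (Sym2 (Vertex d)))ᶜ)] (Q η) :=
    fun η => MeasurableSet.inter (m := sigmaOn _) (hlev η) hπ_meas
  have hQ_union : (⋃ η, Q η) = π := by
    ext ω
    simp only [Set.mem_iUnion, hQ, Set.mem_inter_iff, Set.mem_setOf_eq]
    exact ⟨fun ⟨_, _, h⟩ => h, fun h => ⟨_, rfl, h⟩⟩
  have hQ_disj : Pairwise (Disjoint on Q) := by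
    intro η η' hne
    rw [Function.onFun, Set.disjoint_left]
    rintro ω ⟨h1, _⟩ ⟨h2, _⟩
    exact hne (h1.symm.trans h2)
  -- `A^s` is the disjoint union of the rectangles `cylS F η ∩ Q η`
  have hmod : modified F s A = ⋃ η, cylS F η ∩ Q η := by
    ext ω
    simp only [modified, Set.mem_setOf_eq, Set.mem_iUnion, Set.mem_inter_iff, hQ, hπ]
    constructor
    · rintro ⟨h1, h2⟩
      exact ⟨s (ω \ F), h1, rfl, h2⟩
    · rintro ⟨η, h1, rfl, h2⟩
      exact ⟨h1, h2⟩
  have hrect_disj : Pairwise (Disjoint on fun η => cylS F η ∩ Q η) := by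
    intro η η' hne
    exact (hQ_disj hne).mono Set.inter_subset_right Set.inter_subset_right
  have hrect_meas : ∀ η, MeasurableSet (cylS F η ∩ Q η) :=
    fun η => (measurableSet_cylS F η).inter (sigmaOn_le _ _ (hQ_meas η))
  -- `A ⊆ π(A)`: the inside part of `ω` itself is a completion
  have hAπ : A ⊆ π := by
    intro ω hω
    refine ⟨fun e => decide ((e : Sym2 (Vertex d)) ∈ ω), ?_⟩
    have : extCfg F (fun e => decide ((e : Sym2 (Vertex d)) ∈ ω)) ∪ (ω \ F) = ω := by
      ext e
      simp only [Set.mem_union, Set.mem_sdiff, Finset.mem_coe]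
      constructor
      · rintro (h | h)
        · obtain ⟨_, hη⟩ := h
          exact of_decide_eq_true hη
        · exact h.1
      · intro h
        by_cases he : e ∈ F
        · exact Or.inl ⟨he, decide_eq_true h⟩
        · exact Or.inr ⟨h, he⟩
    rw [this]
    exact hω
  -- the measures
  have hmeasure : P d p (modified F s A) = ∑ η, P d p (cylS F η) * P d p (Q η) := by
    rw [hmod, measure_iUnion hrect_disj hrect_meas, tsum_fintype]
    refine Finset.sum_congr rfl fun η _ => ?_
    exact P_inter_eq_mul_of_disjoint p disjoint_compl_right (measurableSet_sigmaOn_cylS F η) (hQ_meas η)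
  have hπ_sum : P d p π = ∑ η, P d p (Q η) := by
    rw [← hQ_union, measure_iUnion hQ_disj (fun η => sigmaOn_le _ _ (hQ_meas η)), tsum_fintype]
  calc feConst p ^ F.card * P d p A ≤ feConst p ^ F.card * P d p π :=
        mul_le_mul_right (measure_mono hAπ) _
    _ = ∑ η, feConst p ^ F.card * P d p (Q η) := by rw [hπ_sum, Finset.mul_sum]
    _ ≤ ∑ η, P d p (cylS F η) * P d p (Q η) :=
        Finset.sum_le_sum fun η _ => by
          gcongr
          exact feConst_pow_le_measure_cylS p F hF η
    _ = P d p (modified F s A) := hmeasure.symm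

/-- The cylinder «every bond of `F` open». -/
theorem cylS_true_eq (F : Finset (Sym2 (Vertex d))) :
    cylS F (fun _ => true) = {ω : Config d | ∀ e ∈ F, e ∈ ω} := by
  ext ω
  rw [mem_cylS]
  simp only [iff_true, Set.mem_setOf_eq, Subtype.forall]

/-- Lemma 2.1 with the constant choice «every bond of `F` open» (Step 2 of the uniqueness proof):
`min(p, 1−p)^{|F|} · P_p(A) ≤ P_p({ω : F ⊆ ω, and some inside completion of ω ∖ F lies in A})`. -/
theorem finite_energy_allOpen (p : I) (F : Finset (Sym2 (Vertex d))) (hF : ∀ e ∈ F, e ∈ bonds d)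
    {A : Set (Config d)} (hA : MeasurableSet A) :
    feConst p ^ F.card * P d p A ≤
      P d p {ω | (∀ e ∈ F, e ∈ ω) ∧ ∃ η : F → Bool, extCfg F η ∪ (ω \ F) ∈ A} := by
  have h := finite_energy p F hF hA (fun _ => fun _ => true) (fun η => by
    by_cases hη : (fun _ : F => true) = η
    · simp only [hη, Set.setOf_true]
      exact MeasurableSet.univ
    · simp only [hη, Set.setOf_false]
      exact MeasurableSet.empty)
  have hmod : modified F (fun _ => fun _ => true) A =
      {ω | (∀ e ∈ F, e ∈ ω) ∧ ∃ η : F → Bool, extCfg F η ∪ (ω \ F) ∈ A} := by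
    ext ω
    simp only [modified, cylS_true_eq, Set.mem_setOf_eq]
  rwa [hmod] at h

end Summit.Ventures.PercRepro0.FiniteEnergyDefs
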